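import Literature.NumberTheory.Automorphic.RamakrishnanTheoremMProofs
import Literature.NumberTheory.Automorphic.PairLFunctionPolesRepData
import Literature.NumberTheory.Automorphic.CuspidalDescentDetCubicRepData
import Literature.NumberTheory.Automorphic.AutomorphicInductionCharacterCubicProofs
import Literature.NumberTheory.Automorphic.AutomorphicTwistHecke
import HarnessLib

/-!
# Ramakrishnan (2000), Theorem M: the "only if" half of the cuspidality criterion from the
# Jacquet–Shalika leaves, and Theorem M from `Ramakrishnan2000_boxTimes_cuspidal` + Existence

Third sibling proof file (theorems only; no `sorry`, no definition, no named fact) of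
`Literature.NumberTheory.Automorphic.RamakrishnanTensorProductGL2`, whose named fact
`Ramakrishnan2000_theoremM` renders D. Ramakrishnan, *Modularity of the Rankin–Selberg `L`-series,
and multiplicity one for `SL(2)`*, Ann. of Math. (2) **152** (2000), 45–111 [Ramakrishnan2000],
**Theorem M** (§3) with Prop. 3.2.1, at the level of Satake parameters almost everywhere.

The assembly `Ramakrishnan2000_theoremM.of_boxTimes_cuspidal` (`RamakrishnanTheoremMProofs`)
derives `Ramakrishnan2000_theoremM` from the cuspidal-case fact `Ramakrishnan2000_boxTimes_cuspidal`
and two inline hypotheses: (R1) Existence for every cuspidal pair, and (R2) the **"only if" half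
of the cuspidality criterion** — if `π' ≃ π ⊗ χ` (a.e., on Satake parameters) then no *cuspidal*
`Π` on `GL(4)/F` has `t_Π = t_π ⊗ t_{π'}` almost everywhere. This file **proves (R2)** from the
standard named leaves of the tree, following op. cit., proof of Prop. 3.2.1 (p. 20 of the held
preprint `paper:galaxy-pdf-4279542020`): *"Suppose `π' ≃ π ⊗ χ` … by [JS2] and `(L_v)` for almost
all `v`, `L^S(s, π ⊠ π' ⊗ (χω)⁻¹)` must have a pole at `s = 1` … Then `π ⊠ π'` cannot be
cuspidal"* (`ω = ω_π`). In the tree's vocabulary: normalise `t_π = q^{s₁} α`, `α` the unitary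
Satake family of a `π₀ ⊂ L²_cusp` (`CuspidalAutomorphicRepData.exists_satake_eq_cpow_mul_L2_of_clean`,
Borel–Jacquet 1979, 5.7); let `Ω` be the Hecke character with `Ω(ϖ_v) = ∏ t_{π,v}`
(`exists_heckeCharacter_prod_satake_of_normalisation`) and `ν = ‖·‖^{s₁}`. Then `Π ⊗ (χΩ)⁻¹` has
the *unitary* Satake family `α ⊗ α⁻¹ = {a/b, 1, 1, b/a}` (`α = {a, b}`), so by Jacquet–Shalika (2.2)
for the pair (`1` on `GL_1`, `Π ⊗ (χΩ)⁻¹` on `GL_4`; `X = ∅` as `1 ≠ 4`) the Euler product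
`∏_{v ∉ S} det(1 - α_v ⊗ α_v⁻¹ q_v^{-s})⁻¹` has a finite limit at `s = 1`
(`JacquetShalika1981_partialPairL_boundary_repData` — replacing the printed appeal to the entirety
of the standard `L`-function of a cusp form on `GL(4)` [Godement–Jacquet], absent from the tree).
But the same Euler product is `L^S(s, π₁ × π₂)` for the unitary twists `π₁ = π ⊗ ν` (family `α`)
and `π₂ = π ⊗ (νΩ)⁻¹` (family `α⁻¹`, i.e. `π̃₁`), which has a simple pole at `s = 1` by
Jacquet–Shalika (2.3) (`JacquetShalika1981_partialPairL_pole_repData`, `1 ∈ X`): contradiction.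

Contents: `Ramakrishnan2000_theoremM.onlyIf_of_leaves` — (R2) from Jacquet–Shalika (2.2), (2.3)
for Borel–Jacquet data and the Borel–Jacquet dictionary (`exists_isAssociatedL2`,
`hasSatakeParamAt_iff_L2`, `stable_cuspidal_eq_sSup_irreducible`, used on `GL_2` only, to normalise
`π` and to produce `Ω`); `Ramakrishnan2000_theoremM.of_boxTimes_cuspidal_of_leaves` — Theorem M from
`Ramakrishnan2000_boxTimes_cuspidal`, (R1) and those leaves; and the local algebra at one place.
Not here: (R1) (isobaric sums, automorphic induction: absent from the tree) and the cuspidal case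
itself (`Ramakrishnan2000_boxTimes_cuspidal`, the converse-theorem argument of op. cit. §3).

References: [Ramakrishnan2000] Theorem M (§3), proof of Prop. 3.2.1 · [ArthurClozelAMS120]
J. Arthur, L. Clozel, Ann. of Math. Stud. 120 (1989), Ch. 3 §2 (2.2)–(2.3) · [JacquetShalikaAJM1981II]
H. Jacquet, J. A. Shalika, Amer. J. Math. 103 (1981), Prop. 3.6 · [BorelJacquetCorvallis1979]
A. Borel, H. Jacquet, Corvallis 1979, §4.6, 5.7.
-/

noncomputable section

open scoped MatrixGroups Topology Classical
open NumberField IsDedekindDomain MeasureTheory Filter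

namespace Literature.NumberTheory.Automorphic

open AdelicGroupData
open Literature.NumberTheory.GaloisRepresentations (HeckeCharacter)

/-! ### Values of Hecke characters at uniformizers (local copies of standard bookkeeping) -/

section HeckeValues

variable {K : Type} [Field K] [NumberField K]

/-- `(χ₁ χ₂)(ϖ_v) = χ₁(ϖ_v) χ₂(ϖ_v)`. [folklore] -/
private theorem valueAtUniformizer_mul₄ (χ₁ χ₂ : HeckeCharacter K) (v : HeightOneSpectrum (𝓞 K)) :
    (χ₁ * χ₂).valueAtUniformizer v = χ₁.valueAtUniformizer v * χ₂.valueAtUniformizer v := by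
  simp only [GaloisRepresentations.HeckeCharacter.valueAtUniformizer,
    GaloisRepresentations.HeckeCharacter.localComponent_apply,
    GaloisRepresentations.HeckeCharacter.mul_apply, Units.val_mul]

/-- `χ⁻¹(ϖ_v) = χ(ϖ_v)⁻¹`. [folklore] -/
private theorem valueAtUniformizer_inv₄ (χ : HeckeCharacter K) (v : HeightOneSpectrum (𝓞 K)) :
    χ⁻¹.valueAtUniformizer v = (χ.valueAtUniformizer v)⁻¹ := by
  simp only [GaloisRepresentations.HeckeCharacter.valueAtUniformizer,
    GaloisRepresentations.HeckeCharacter.localComponent_apply,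
    GaloisRepresentations.HeckeCharacter.inv_apply, Units.val_inv_eq_inv_val]

/-- `χ(ϖ_v) ≠ 0`. [folklore] -/
private theorem valueAtUniformizer_ne_zero₄ (χ : HeckeCharacter K) (v : HeightOneSpectrum (𝓞 K)) :
    χ.valueAtUniformizer v ≠ 0 := by
  simp only [GaloisRepresentations.HeckeCharacter.valueAtUniformizer]
  exact Units.ne_zero _

/-- `1(ϖ_v) = 1`. [folklore] -/
private theorem valueAtUniformizer_one₄ (v : HeightOneSpectrum (𝓞 K)) :
    (1 : HeckeCharacter K).valueAtUniformizer v = 1 := by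
  simp only [GaloisRepresentations.HeckeCharacter.valueAtUniformizer,
    GaloisRepresentations.HeckeCharacter.localComponent_apply,
    GaloisRepresentations.HeckeCharacter.one_apply, Units.val_one]

end HeckeValues

/-! ### Local algebra at one unramified place of `GL(2)` -/

section LocalAlgebra

/-- Untwisting the normalisation: `c⁻¹ · (c α) = α`. [folklore] -/
theorem map_inv_mul_map_mul (α : Multiset ℂ) {c : ℂ} (hc : c ≠ 0) :
    (α.map (c * ·)).map (c⁻¹ * ·) = α := by
  simp only [Multiset.map_map, Function.comp_def, ← mul_assoc, inv_mul_cancel₀ hc, one_mul,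
    Multiset.map_id']

/-- `(β⁻¹)⁻¹ = β` entrywise. [folklore] -/
theorem map_inv_map_inv (β : Multiset ℂ) : (β.map (·⁻¹)).map (·⁻¹) = β := by
  simp only [Multiset.map_map, Function.comp_def, inv_inv, Multiset.map_id']

/-- **The contragredient twist on `GL(2)`**: for `t = {ca, cb}` (`= q^{s₁} α`, `α = {a, b}`) and
`k = (c⁻¹ · ∏ t)⁻¹` (`= ((νΩ)(ϖ_v))⁻¹` with `ν(ϖ_v) = c⁻¹`, `Ω(ϖ_v) = ∏ t`), `k · t = {a⁻¹, b⁻¹}`: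
the Satake parameter of `π ⊗ (νω_π)⁻¹` is `α⁻¹`, that of the contragredient of `π ⊗ ν`
(`π̃ ≅ π ⊗ ω_π⁻¹` on `GL(2)`).
[cite: Ramakrishnan2000, proof of Prop. 3.2.1] -/
theorem pair_map_contragredientTwist {a b c : ℂ} (ha : a ≠ 0) (hb : b ≠ 0) (hc : c ≠ 0) :
    ({c * a, c * b} : Multiset ℂ).map ((c⁻¹ * (c * a * (c * b)))⁻¹ * ·) = {a⁻¹, b⁻¹} := by
  have e1 : (c⁻¹ * (c * a * (c * b)))⁻¹ * (c * a) = b⁻¹ := by field_simp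
  have e2 : (c⁻¹ * (c * a * (c * b)))⁻¹ * (c * b) = a⁻¹ := by field_simp
  simp only [Multiset.insert_eq_cons, Multiset.map_cons, Multiset.map_zero, e1, e2,
    ← Multiset.cons_zero]
  exact Multiset.cons_swap b⁻¹ a⁻¹ 0

/-- **`(π ⊠ (π ⊗ χ)) ⊗ (χω_π)⁻¹` has Satake parameter `α ⊗ α⁻¹` on `GL(4)`**: for `t = {ca, cb}`,
`x = χ(ϖ_v)` and `∏ t = ω(ϖ_v)`,
`(x ∏ t)⁻¹ · (t ⊗ x t) = {a/b, 1, 1, b/a} = {a, b} ⊗ {a⁻¹, b⁻¹}` (op. cit.: "`L^S(s, π ⊠ π' ⊗ (χω)⁻¹)`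
… `= L^S(s, π × π̃)`" at the unramified places). [cite: Ramakrishnan2000, proof of Prop. 3.2.1] -/
theorem satakeTensor_twist_map_eq {a b c x : ℂ} (ha : a ≠ 0) (hb : b ≠ 0) (hc : c ≠ 0)
    (hx : x ≠ 0) :
    (satakeTensor ({c * a, c * b} : Multiset ℂ) (({c * a, c * b} : Multiset ℂ).map (x * ·))).map
        ((x * (c * a * (c * b)))⁻¹ * ·) =
      satakeTensor ({a, b} : Multiset ℂ) ({a⁻¹, b⁻¹} : Multiset ℂ) := by
  have e1 : (x * (c * a * (c * b)))⁻¹ * (c * a * (x * (c * a))) = a * b⁻¹ := by field_simp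
  have e2 : (x * (c * a * (c * b)))⁻¹ * (c * a * (x * (c * b))) = 1 := by field_simp
  have e3 : (x * (c * a * (c * b)))⁻¹ * (c * b * (x * (c * a))) = 1 := by field_simp
  have e4 : (x * (c * a * (c * b)))⁻¹ * (c * b * (x * (c * b))) = b * a⁻¹ := by field_simp
  have f1 : a * a⁻¹ = 1 := mul_inv_cancel₀ ha
  have f4 : b * b⁻¹ = 1 := mul_inv_cancel₀ hb
  have hm : ({c * a, c * b} : Multiset ℂ).map (x * ·) = {x * (c * a), x * (c * b)} := by
    simp only [Multiset.insert_eq_cons, Multiset.map_cons, Multiset.map_singleton]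
  rw [hm, satakeTensor_pair_pair, satakeTensor_pair_pair]
  simp only [Multiset.insert_eq_cons, Multiset.map_cons, Multiset.map_zero, e1, e2, e3, e4, f1, f4,
    ← Multiset.cons_zero]
  -- `{a/b, 1, 1, b/a} = {1, a/b, b/a, 1}`
  rw [Multiset.cons_swap (a * b⁻¹) (1 : ℂ), Multiset.cons_swap (1 : ℂ) (b * a⁻¹) 0]

/-- `|∏ ({a, b} ⊗ {a⁻¹, b⁻¹})| = 1` (indeed the product is `1`): the family `α ⊗ α⁻¹` is unitary.
[folklore] -/
theorem norm_prod_satakeTensor_pair_inv {a b : ℂ} (ha : a ≠ 0) (hb : b ≠ 0) :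
    ‖(satakeTensor ({a, b} : Multiset ℂ) ({a⁻¹, b⁻¹} : Multiset ℂ)).prod‖ = 1 := by
  rw [satakeTensor_pair_pair]
  simp only [Multiset.insert_eq_cons, Multiset.prod_cons, Multiset.prod_singleton]
  rw [show a * a⁻¹ * (a * b⁻¹ * (b * a⁻¹ * (b * b⁻¹))) = 1 by field_simp, norm_one]

/-- `∏ {a, b}` has norm one forces `a, b ≠ 0`. [folklore] -/
theorem ne_zero_of_norm_prod_pair_eq_one {a b : ℂ} (h : ‖({a, b} : Multiset ℂ).prod‖ = 1) :
    a ≠ 0 ∧ b ≠ 0 := by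
  rw [Multiset.prod_pair] at h
  have hab : a * b ≠ 0 := fun h0 => by simp [h0] at h
  exact ⟨left_ne_zero_of_mul hab, right_ne_zero_of_mul hab⟩

end LocalAlgebra

/-! ### (R2): the "only if" half of the cuspidality criterion from the leaves -/

section OnlyIf

/-- For `n = 1` every automorphic representation datum is cuspidal (the cusp conditions are
empty; Borel–Jacquet 1979, 4.4 — the tree's `cuspFormsGL_one_eq_automorphicForms`, re-proved to
keep the imports of this file small). [cite: BorelJacquetCorvallis1979, §4.4] -/
private theorem W_le_cuspFormsGL_one₄ {K : Type} [Field K] [NumberField K]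
    {h : isCompact_glFiniteIntegralLevel 1 K} (τ : AutomorphicRepData (AutomorphyDatum.gl 1 K h)) :
    τ.W ≤ cuspFormsGL 1 K h := by
  have e : cuspFormsGL 1 K h = automorphicForms (AutomorphyDatum.gl 1 K h) := by
    unfold cuspFormsGL automorphicForms; congr 1; ext φ
    simp only [Set.mem_setOf_eq, IsCuspFormGL, and_iff_left_iff_imp]
    intro _ k hk hk1
    exact absurd hk1 (by omega)
  rw [e]
  exact τ.stable.le_automorphicForms

/-- **Ramakrishnan 2000, Theorem M, cuspidality criterion, "only if" half — from the leaves.**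
Granting Jacquet–Shalika (2.2) and (2.3) for cuspidal Borel–Jacquet data
(`JacquetShalika1981_partialPairL_boundary_repData`, `JacquetShalika1981_partialPairL_pole_repData`;
Arthur–Clozel Ch. 3 (2.2)–(2.3), Jacquet–Shalika II Prop. 3.6) and the Borel–Jacquet dictionary
(`AutomorphicRepsGL.exists_isAssociatedL2`, `hasSatakeParamAt_iff_L2`,
`AutomorphicRepsGL.stable_cuspidal_eq_sSup_irreducible`): for cuspidal `π, π'` on `GL(2)/F`
(arbitrary central characters) and a Hecke character `χ` with `π' ≃ π ⊗ χ` on Satake parameters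
almost everywhere (`IsSatakeTwistBy π π' χ`), there is **no cuspidal** `Π` on `GL(4)/F` with
`t_{Π,v} = t_{π,v} ⊗ t_{π',v}` for almost all `v`. (Op. cit., proof of Prop. 3.2.1: "Suppose
`π' ≃ π ⊗ χ` … `L^S(s, π ⊠ π' ⊗ (χω)⁻¹)` must have a pole at `s = 1` … Then `π ⊠ π'` cannot be
cuspidal"; here the pole comes from (2.3) for the unitary pair `(π ⊗ ν, π ⊗ (νω)⁻¹)`, `ν = ‖·‖^{s₁}`,
and the holomorphy of the twisted standard `L`-function of a cuspidal `Π` at `s = 1` from (2.2)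
for the pair (`1` on `GL_1`, `Π ⊗ (χω)⁻¹` on `GL_4`), `X = ∅`; module docstring.)
[cite: Ramakrishnan2000, Theorem M (§3) and proof of Prop. 3.2.1]
[cite: ArthurClozelAMS120, Ch. 3 §2 (2.2)–(2.3)] -/
theorem Ramakrishnan2000_theoremM.onlyIf_of_leaves
    (h22 : JacquetShalika1981_partialPairL_boundary_repData)
    (h23 : JacquetShalika1981_partialPairL_pole_repData)
    (hA : ∀ {n : ℕ} {K : Type} [Field K] [NumberField K] (hK : isCompact_glFiniteIntegralLevel n K)
      (μ : Measure (gl n K).automorphicQuotient) [(gl n K).IsAutomorphicMeasure μ],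
      AutomorphicRepsGL.exists_isAssociatedL2 hK μ)
    (hL2 : ∀ {n : ℕ} {K : Type} [Field K] [NumberField K] (hK : isCompact_glFiniteIntegralLevel n K)
      (μ : Measure (gl n K).automorphicQuotient) [(gl n K).IsAutomorphicMeasure μ],
      hasSatakeParamAt_iff_L2 hK μ)
    (hss : ∀ {n : ℕ} {K : Type} [Field K] [NumberField K] (hK : isCompact_glFiniteIntegralLevel n K),
      AutomorphicRepsGL.stable_cuspidal_eq_sSup_irreducible hK)
    (F : Type) [Field F] [NumberField F]
    (h2 : isCompact_glFiniteIntegralLevel 2 F) (h4 : isCompact_glFiniteIntegralLevel 4 F)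
    (π π' : CuspidalAutomorphicRepData 2 F h2) (χ : HeckeCharacter F)
    (hχ : IsSatakeTwistBy π.1 π'.1 χ) :
    ¬ ∃ P : CuspidalAutomorphicRepData 4 F h4,
        ∀ᶠ v : HeightOneSpectrum (𝓞 F) in cofinite, ∀ α β : Multiset ℂ,
          π.1.HasSatakeParamAt v α → π'.1.HasSatakeParamAt v β →
            P.1.HasSatakeParamAt v (satakeTensor α β) := by
  rintro ⟨P, hP⟩
  rw [isSatakeTwistBy_iff] at hχ
  haveI : NeZero (2 : ℕ) := ⟨by norm_num⟩
  haveI : NeZero (4 : ℕ) := ⟨by norm_num⟩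
  -- the unitary normalisation `t_π = q^{s₁} αP` of `π` (Borel–Jacquet 5.7)
  obtain ⟨μ, hμ⟩ := AdelicGroupData.exists_isAutomorphicMeasure_gl_holds 2 F
  haveI := hμ
  obtain ⟨π₀, h0W', h0π⟩ :=
    CuspidalAutomorphicRepData.exists_clean_hasSatakeParamAt_of_sSup_irreducible (hss h2) π
  obtain ⟨s₁, P₂, S₁, αP, hS₁, hαP, hiff⟩ :=
    CuspidalAutomorphicRepData.exists_satake_eq_cpow_mul_L2_of_clean (hA h2 μ) (hL2 h2 μ) π π₀
      h0W' h0π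
  -- `Ω(ϖ_v) = ∏ t_{π,v}` (central character) and `ν = ‖·‖^{s₁}`, `ν(ϖ_v) = q_v^{-s₁}`
  obtain ⟨Ω, hΩ⟩ := exists_heckeCharacter_prod_satake_of_normalisation π hS₁ hαP hiff
  obtain ⟨ν, hν⟩ := exists_heckeCharacter_ideleNorm_cpow F s₁
  -- the twists `π₁ = π ⊗ ν`, `π₂ = π ⊗ (νΩ)⁻¹`, `P♭ = P ⊗ (χΩ)⁻¹`
  obtain ⟨π₁, hπ₁⟩ := CuspidalAutomorphicRepData.exists_twist_hecke_hasSatakeParamAt ν π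
  obtain ⟨π₂, hπ₂⟩ := CuspidalAutomorphicRepData.exists_twist_hecke_hasSatakeParamAt (ν * Ω)⁻¹ π
  obtain ⟨Pb, hPb⟩ := CuspidalAutomorphicRepData.exists_twist_hecke_hasSatakeParamAt (χ * Ω)⁻¹ P
  -- the trivial representation `1` of `GL_1(𝔸_F)`
  have h1 : isCompact_glFiniteIntegralLevel 1 F := isCompact_glFiniteIntegralLevel_holds 1 F
  obtain ⟨τ, hτ⟩ :=
    exists_automorphicRepData_hasSatakeParamAt_valueAtUniformizer h1 (1 : HeckeCharacter F)
  set σ : CuspidalAutomorphicRepData 1 F h1 := ⟨τ, W_le_cuspFormsGL_one₄ τ⟩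
  -- the families: `αP` (of `π₁`), `β = αP⁻¹` (of `π₂`), `A = αP ⊗ αP⁻¹` (of `P♭`), `B = {1}` (of `σ`)
  set β : SatakeFamily F := fun w => (αP w).map (·⁻¹) with hβ
  set A : SatakeFamily F := fun w => satakeTensor (αP w) (β w) with hAdef
  set B : SatakeFamily F := fun _ => ({1} : Multiset ℂ) with hB
  -- good places: all four data have the displayed parameters
  have hgood : ∀ᶠ w : HeightOneSpectrum (𝓞 F) in cofinite,
      π₁.1.HasSatakeParamAt w (αP w) ∧ π₂.1.HasSatakeParamAt w (β w) ∧
        Pb.1.HasSatakeParamAt w (A w) ∧ σ.1.HasSatakeParamAt w (B w) := by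
    filter_upwards [hP, hχ, hΩ, hπ₁, hπ₂, hPb, hτ, hS₁.eventually_cofinite_notMem] with w hPw hχw
      hΩw hπ₁w hπ₂w hPbw hτw hwS₁
    -- data at `w`: `αP w = {a, b}`, `a b ≠ 0`, `c = q_w^{s₁} ≠ 0`, `t_{π,w} = T = {ca, cb}`
    obtain ⟨𝔫, -, -, ϖ, hSat⟩ := hαP w hwS₁
    obtain ⟨a, b, hab⟩ := Multiset.card_eq_two.1 hSat.card_eq
    have hunit : ‖(αP w).prod‖ = 1 := hSat.norm_prod_eq_one
    rw [hab] at hunit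
    obtain ⟨ha, hb⟩ := ne_zero_of_norm_prod_pair_eq_one hunit
    set c : ℂ := (w.residueCard : ℂ) ^ s₁
    have hq : (w.residueCard : ℂ) ≠ 0 :=
      Nat.cast_ne_zero.2 (zero_lt_one.trans w.one_lt_residueCard).ne'
    have hc0 : c ≠ 0 := fun h0 => hq ((Complex.cpow_eq_zero_iff _ _).1 h0).1
    set T : Multiset ℂ := (αP w).map (c * ·) with hT
    have hπT : π.1.HasSatakeParamAt w T := (hiff w hwS₁ T).2 rfl
    have hTab : T = {c * a, c * b} := by
      rw [hT, hab]
      simp only [Multiset.insert_eq_cons, Multiset.map_cons, Multiset.map_singleton]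
    have hTprod : T.prod = c * a * (c * b) := by rw [hTab, Multiset.prod_pair]
    have hΩw' : Ω.valueAtUniformizer w = c * a * (c * b) := (hΩw T hπT).trans hTprod
    have hνw : ν.valueAtUniformizer w = c⁻¹ := HeckeCharacter.valueAtUniformizer_of_cpow hν w
    have hχ0 := valueAtUniformizer_ne_zero₄ χ w
    refine ⟨?_, ?_, ?_, ?_⟩
    · -- `π₁ = π ⊗ ν`: `ν(ϖ) · T = αP w`
      have h := hπ₁w T hπT
      rwa [hνw, hT, map_inv_mul_map_mul _ hc0] at h
    · -- `π₂ = π ⊗ (νΩ)⁻¹`: `(νΩ)⁻¹(ϖ) · T = (αP w)⁻¹`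
      have h := hπ₂w T hπT
      rw [valueAtUniformizer_inv₄, valueAtUniformizer_mul₄, hνw, hΩw', hTab,
        pair_map_contragredientTwist ha hb hc0] at h
      have e : β w = {a⁻¹, b⁻¹} := by
        simp only [hβ, hab, Multiset.insert_eq_cons, Multiset.map_cons, Multiset.map_singleton]
      rwa [e]
    · -- `P♭ = P ⊗ (χΩ)⁻¹`: `(χΩ)⁻¹(ϖ) · (T ⊗ χ(ϖ) T) = αP w ⊗ (αP w)⁻¹`
      have h := hPbw _ (hPw T _ hπT (hχw T hπT))
      rw [valueAtUniformizer_inv₄, valueAtUniformizer_mul₄, hΩw', hTab,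
        satakeTensor_twist_map_eq ha hb hc0 hχ0] at h
      have e : A w = satakeTensor ({a, b} : Multiset ℂ) ({a⁻¹, b⁻¹} : Multiset ℂ) := by
        simp only [hAdef, hβ, hab, Multiset.insert_eq_cons, Multiset.map_cons,
          Multiset.map_singleton]
      rwa [e]
    · -- `σ = 1` on `GL_1`
      have h := hτw
      rwa [valueAtUniformizer_one₄] at h
  -- the finite exceptional set
  obtain ⟨S₂, hS₂, H22⟩ := h22 1 4 F h1 h4 one_pos (by norm_num) σ Pb
  obtain ⟨S₃, hS₃, H23⟩ := h23 2 F h2 two_pos π₁ π₂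
  set S : Set (HeightOneSpectrum (𝓞 F)) := S₁ ∪ S₂ ∪ S₃ ∪
    {w | ¬ (π₁.1.HasSatakeParamAt w (αP w) ∧ π₂.1.HasSatakeParamAt w (β w) ∧
      Pb.1.HasSatakeParamAt w (A w) ∧ σ.1.HasSatakeParamAt w (B w))}
  have hSfin : S.Finite :=
    ((hS₁.union hS₂).union hS₃).union (Filter.eventually_cofinite.1 hgood)
  have hS₁S : S₁ ⊆ S := fun w hw => Or.inl (Or.inl (Or.inl hw))
  have hS₂S : S₂ ⊆ S := fun w hw => Or.inl (Or.inl (Or.inr hw))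
  have hS₃S : S₃ ⊆ S := fun w hw => Or.inl (Or.inr hw)
  have hgoodS : ∀ w ∉ S, π₁.1.HasSatakeParamAt w (αP w) ∧ π₂.1.HasSatakeParamAt w (β w) ∧
      Pb.1.HasSatakeParamAt w (A w) ∧ σ.1.HasSatakeParamAt w (B w) := by
    intro w hw
    by_contra h
    exact hw (Or.inr h)
  -- unitarity of the four families off `S`
  have hu₁ : ∀ w ∉ S, ‖(αP w).prod‖ = 1 := by
    intro w hw
    obtain ⟨𝔫, -, -, ϖ, hSat⟩ := hαP w (fun h => hw (hS₁S h))
    exact hSat.norm_prod_eq_one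
  have hu₂ : ∀ w ∉ S, ‖(β w).prod‖ = 1 := by
    intro w hw
    simp only [hβ, Multiset.prod_map_inv', norm_inv, hu₁ w hw, inv_one]
  have huA : ∀ w ∉ S, ‖(A w).prod‖ = 1 := by
    intro w hw
    obtain ⟨𝔫, -, -, ϖ, hSat⟩ := hαP w (fun h => hw (hS₁S h))
    obtain ⟨a, b, hab⟩ := Multiset.card_eq_two.1 hSat.card_eq
    have hunit : ‖(αP w).prod‖ = 1 := hSat.norm_prod_eq_one
    rw [hab] at hunit
    obtain ⟨ha, hb⟩ := ne_zero_of_norm_prod_pair_eq_one hunit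
    have e : A w = satakeTensor ({a, b} : Multiset ℂ) ({a⁻¹, b⁻¹} : Multiset ℂ) := by
      simp only [hAdef, hβ, hab, Multiset.insert_eq_cons, Multiset.map_cons,
        Multiset.map_singleton]
    rw [e]
    exact norm_prod_satakeTensor_pair_inv ha hb
  have huB : ∀ w ∉ S, ‖(B w).prod‖ = 1 := fun w _ => by simp [hB]
  -- (2.3) for `(π₁, π₂)`: `1 ∈ X`, a simple pole of `L^S(s, αP ⊗ αP⁻¹)` at `s = 1`
  have hX : ∀ᶠ w : HeightOneSpectrum (𝓞 F) in cofinite,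
      (αP w).map ((((w.residueCard : ℂ)) ^ (1 - (1 : ℂ))) * ·) = (β w).map (·⁻¹) :=
    Filter.Eventually.of_forall fun w => by
      simp only [hβ, sub_self, Complex.cpow_zero, one_mul, Multiset.map_id', map_inv_map_inv]
  obtain ⟨c, hc, hpole⟩ := H23 hSfin hS₃S (fun w hw => (hgoodS w hw).1)
    (fun w hw => (hgoodS w hw).2.1) hu₁ hu₂ Complex.one_re hX
  -- (2.2) for `(σ, P♭)` on `GL_1 × GL_4`: `X = ∅`, a finite limit of `L^S(s, {1} ⊗ A)` at `s = 1`
  obtain ⟨d, -, hlim⟩ := H22 hSfin hS₂S (fun w hw => (hgoodS w hw).2.2.2)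
    (fun w hw => (hgoodS w hw).2.2.1) huB huA Complex.one_re (fun h => absurd h.1 (by decide))
  -- the two Euler products coincide factor by factor
  have hLL : partialPairL S B A = partialPairL S αP β := by
    funext s
    simp only [partialPairL]
    refine tprod_congr fun v => ?_
    rw [satakePairPolynomial_eq_eulerPolynomial, satakePairPolynomial_eq_eulerPolynomial, hB,
      satakeTensor_singleton_left]
    simp only [one_mul, Multiset.map_id', hAdef]
  rw [hLL] at hlim
  have h0 : Tendsto (fun s => (s - 1) * partialPairL S αP β s) (𝓝[{s : ℂ | 1 < s.re}] 1)
      (𝓝 (0 * d)) :=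
    tendsto_sub_one_nhdsWithin_one_lt_re.mul hlim
  rw [zero_mul] at h0
  exact hc (tendsto_nhds_unique hpole h0)

end OnlyIf

/-! ### Theorem M from `Ramakrishnan2000_boxTimes_cuspidal`, Existence, and the leaves -/

section Assembly

/-- **`Ramakrishnan2000_theoremM` from the cuspidal-case fact, the Existence clause and the
standard leaves.** Theorem M (`Ramakrishnan2000_theoremM`) follows from
`Ramakrishnan2000_boxTimes_cuspidal` (Theorem M, cuspidal non-dihedral case), the Existence clause
(R1) for every cuspidal pair (op. cit. Lemma 3.1.1 (II), (III): isobaric `π ⊠ π'` for dihedral or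
twist-equivalent pairs — automorphic induction and isobaric sums, stated inline), Jacquet–Shalika
(2.2), (2.3) for Borel–Jacquet data and the Borel–Jacquet dictionary: the assembly
`Ramakrishnan2000_theoremM.of_boxTimes_cuspidal` with its hypothesis (R2) discharged by
`Ramakrishnan2000_theoremM.onlyIf_of_leaves`.
[cite: Ramakrishnan2000, Theorem M (§3), Lemma 3.1.1 and Prop. 3.2.1] -/
theorem Ramakrishnan2000_theoremM.of_boxTimes_cuspidal_of_leaves
    (h : Ramakrishnan2000_boxTimes_cuspidal)
    (hR1 : ∀ (F : Type) [Field F] [NumberField F]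
      (h2 : isCompact_glFiniteIntegralLevel 2 F) (h4 : isCompact_glFiniteIntegralLevel 4 F)
      (π π' : CuspidalAutomorphicRepData 2 F h2),
      ∃ P : AutomorphicRepData (AutomorphyDatum.gl 4 F h4),
        ∀ᶠ v : HeightOneSpectrum (𝓞 F) in cofinite, ∀ α β : Multiset ℂ,
          π.1.HasSatakeParamAt v α → π'.1.HasSatakeParamAt v β →
            P.HasSatakeParamAt v (satakeTensor α β))
    (h22 : JacquetShalika1981_partialPairL_boundary_repData)
    (h23 : JacquetShalika1981_partialPairL_pole_repData)
    (hA : ∀ {n : ℕ} {K : Type} [Field K] [NumberField K] (hK : isCompact_glFiniteIntegralLevel n K)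
      (μ : Measure (gl n K).automorphicQuotient) [(gl n K).IsAutomorphicMeasure μ],
      AutomorphicRepsGL.exists_isAssociatedL2 hK μ)
    (hL2 : ∀ {n : ℕ} {K : Type} [Field K] [NumberField K] (hK : isCompact_glFiniteIntegralLevel n K)
      (μ : Measure (gl n K).automorphicQuotient) [(gl n K).IsAutomorphicMeasure μ],
      hasSatakeParamAt_iff_L2 hK μ)
    (hss : ∀ {n : ℕ} {K : Type} [Field K] [NumberField K] (hK : isCompact_glFiniteIntegralLevel n K),
      AutomorphicRepsGL.stable_cuspidal_eq_sSup_irreducible hK) :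
    Ramakrishnan2000_theoremM :=
  Ramakrishnan2000_theoremM.of_boxTimes_cuspidal h hR1 fun F _ _ h2 h4 π π' χ hχ =>
    Ramakrishnan2000_theoremM.onlyIf_of_leaves h22 h23 hA hL2 hss F h2 h4 π π' χ hχ

end Assembly

end Literature.NumberTheory.Automorphic

end
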